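import Summits.AtomisticToContinuum.Crystallization.Theses.PerronTransitivity
import Literature.MathematicalPhysics.StatisticalMechanics.TwoScaleShellSums
import Literature.MathematicalPhysics.StatisticalMechanics.MuGroundStateConfiguration
import Literature.MathematicalPhysics.StatisticalMechanics.LocalMatchingCompactness

/-!
# Crux `TransitiveLocalLimit` (stmt-AtomisticToContinuum-15100), line `birth` — stub `stub_siteEnergyContinuity`

STUB 4 of the skeleton `Cruxes/TransitiveLocalLimit/Lines/birth.lean` (CONTINUITY OF SITE ENERGIES
UNDER SEPARATED LOCAL CONVERGENCE): if uniformly `δ`-separated finite configurations `z j` of `ℝ³`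
(`n j` particles) are two-way matched, on every ball about `0` and eventually in `j`, with a uniformly
discrete set `X`, then for every `p ∈ X` and `γ > 0` there is `ε > 0` such that, eventually in `j`,
EVERY particle of `z j` within `ε` of `p` has Lennard-Jones site energy within `γ` of the site
energy of `X` at `p`, `U = Σ'_{q ∈ X, q ≠ p} V_LJ(|p − q|)` (absolutely summable,
`UniformlyDiscrete.summable_lennardJones_dist`).

Proof (order of choices `ρ → (ρ', g) → Q → ω → ε → j`; `η := min δ δ_X`).
* TAILS (`sum_abs_lennardJones_le_of_le_dist`, from `sum_abs_lennardJones_le_two_scale`): an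
  `η`-separated family of points all at distance `≥ ρ ≥ η` from a centre has
  `Σ |V_LJ| ≤ C_η ρ⁻³`; choose `ρ` with `C_η ρ⁻³ ≤ γ/4`.
* GENERIC RADIUS (`exists_generic_shell_radius`): the distances `|p − q|`, `q ∈ X ∩ B̄(p, ρ + 1)`, are
  finitely many (`finite_of_forall_le_dist_of_subset_closedBall`), so some `ρ' ∈ (ρ, ρ + 1)` and gap
  `g > 0` have NO point of `X` at distance in `(ρ' − g, ρ' + g)` from `p`, and `ρ' + g ≤ ρ + 1`.
* MODULUS: `Q := {q ∈ X ∖ {p} : |p − q| ≤ ρ'}` is finite; `V_LJ` is uniformly continuous on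
  `[η, ρ + 2]` (`continuousOn_lennardJones`, compactness): `ω > 0` with oscillation `< γ/(4(#Q + 1))`.
* PAIRING (`exists_local_pairing`): for `ε := min (g/4) (η/4) (ω/3)` and `j` late enough that `z j`
  and `X` are two-way `ε`-matched on the ball of radius `‖p‖ + ρ + 2`, and a particle `i` within `ε`
  of `p`, the matching is a BIJECTION between the particles `i' ≠ i` within `ρ'` of particle `i` and
  `Q`, moving each point by `≤ ε` (the gap `g > 2ε` makes "within `ρ'`" stable, the separations
  `> 2ε` make the matching single-valued and injective both ways).
* ASSEMBLY: the inner sums differ termwise by the oscillation of `V_LJ` over `2ε < ω` (`#Q` terms,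
  total `≤ γ/4`), the particle tail beyond `ρ'` is `≤ γ/4`, and every finite piece of the `X`-tail
  beyond `ρ'` is `≤ γ/4`; the `tsum` is reached through its finite partial sums
  (`abs_sub_tsum_le_of_forall_finset`). Total `≤ 3γ/4 ≤ γ`.
-/

noncomputable section

namespace Summit.AtomisticToContinuum.Crystallization.Theorems.TransitiveLocalLimitBirth

open Literature.MathematicalPhysics.StatisticalMechanics Filter Metric

/-! ## Tails of separated families -/

/-- **Far partners, indexed form.** If a finite family of points `v a`, `a ∈ s`, of `ℝ³` is pairwise
`≥ η` apart (`η > 0`) and every member is at distance `≥ ρ ≥ η` from a point `p`, then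
`Σ_{a ∈ s} |V_LJ(|p − v a|)| ≤ (η⁻⁶/12 + 1/6) · 250 η⁻³ · ρ⁻³`: the family is injective on `s`, so this
is `sum_abs_lennardJones_le_two_scale` for the image finset. -/
theorem sum_abs_lennardJones_le_of_le_dist {ι : Type*} (s : Finset ι)
    (v : ι → EuclideanSpace ℝ (Fin 3)) (p : EuclideanSpace ℝ (Fin 3)) {η ρ : ℝ} (hη : 0 < η)
    (hηρ : η ≤ ρ) (hsep : ∀ a ∈ s, ∀ b ∈ s, a ≠ b → η ≤ dist (v a) (v b))
    (hp : ∀ a ∈ s, ρ ≤ dist p (v a)) :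
    ∑ a ∈ s, |lennardJones (dist p (v a))| ≤
      (η⁻¹ ^ 6 / 12 + 1 / 6) * (250 * η⁻¹ ^ 3) * ρ⁻¹ ^ 3 := by
  classical
  have hinj : Set.InjOn v s := by
    intro a ha b hb hab
    by_contra h
    have h1 := hsep a ha b hb h
    rw [hab, dist_self] at h1
    exact absurd h1 (not_le.2 hη)
  rw [← Finset.sum_image (f := fun x => |lennardJones (dist p x)|) hinj]
  refine (sum_abs_lennardJones_le_two_scale _ p hη hηρ ?_ ?_).trans_eq (by ring)
  · intro x hx w hw hxw
    obtain ⟨a, ha, rfl⟩ := Finset.mem_image.1 hx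
    obtain ⟨b, hb, rfl⟩ := Finset.mem_image.1 hw
    exact hsep a ha b hb fun h => hxw (congrArg v h)
  · intro x hx
    obtain ⟨a, ha, rfl⟩ := Finset.mem_image.1 hx
    exact hp a ha

/-- Closing a uniform bound over finite partial sums: if `f` is summable and `|A − Σ_{T'} f| ≤ c` for
every finite `T' ⊇ T`, then `|A − Σ' f| ≤ c` (the partial sums tend to the `tsum` along `atTop`). -/
theorem abs_sub_tsum_le_of_forall_finset {ι : Type*} {f : ι → ℝ} (hf : Summable f)
    (T : Finset ι) {A c : ℝ} (h : ∀ T' : Finset ι, T ⊆ T' → |A - ∑ q ∈ T', f q| ≤ c) :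
    |A - ∑' q, f q| ≤ c := by
  have ht : Tendsto (fun T' : Finset ι => ∑ q ∈ T', f q) atTop (nhds (∑' q, f q)) := hf.hasSum
  exact le_of_tendsto (tendsto_const_nhds.sub ht).abs (Filter.eventually_atTop.2 ⟨T, h⟩)

/-! ## A generic radius -/

/-- **Generic radius.** For a uniformly discrete `X ⊆ ℝ³`, a point `p` and a radius `ρ` there are
`ρ' ∈ [ρ, ρ + 1)` and a gap `g > 0` with `ρ' + g ≤ ρ + 1` such that NO point of `X` is at distance in
`(ρ' − g, ρ' + g)` from `p`: the distances `|p − q|`, `q ∈ X ∩ B̄(p, ρ + 1)`, form a finite set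
(`finite_of_forall_le_dist_of_subset_closedBall`), the interval `(ρ, ρ + 1)` is infinite, and a finite
set of reals is closed. -/
theorem exists_generic_shell_radius {X : Set (EuclideanSpace ℝ (Fin 3))} {δX : ℝ} (hδX : 0 < δX)
    (hXsep : ∀ a ∈ X, ∀ b ∈ X, a ≠ b → δX ≤ dist a b) (p : EuclideanSpace ℝ (Fin 3)) (ρ : ℝ) :
    ∃ ρ' g : ℝ, 0 < g ∧ ρ ≤ ρ' ∧ ρ' + g ≤ ρ + 1 ∧
      ∀ q ∈ X, dist p q ≤ ρ' - g ∨ ρ' + g ≤ dist p q := by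
  have hfin : (X ∩ closedBall p (ρ + 1)).Finite :=
    finite_of_forall_le_dist_of_subset_closedBall hδX
      (fun a ha b hb hab => hXsep a ha.1 b hb.1 hab) Set.inter_subset_right
  have hD : ((fun q => dist p q) '' (X ∩ closedBall p (ρ + 1))).Finite := hfin.image _
  obtain ⟨ρ', ⟨hρ'1, hρ'2⟩, hρ'D⟩ := ((Set.Ioo_infinite (lt_add_one ρ)).sdiff hD).nonempty
  obtain ⟨e, he, hball⟩ := Metric.isOpen_iff.1 hD.isClosed.isOpen_compl ρ' hρ'D
  refine ⟨ρ', min e (ρ + 1 - ρ'), lt_min he (by linarith), hρ'1.le,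
    by linarith [min_le_right e (ρ + 1 - ρ')], fun q hq => ?_⟩
  have hmin := min_le_left e (ρ + 1 - ρ')
  by_cases hq1 : dist p q ≤ ρ + 1
  · have hdD : dist p q ∈ (fun q => dist p q) '' (X ∩ closedBall p (ρ + 1)) :=
      ⟨q, ⟨hq, mem_closedBall'.2 hq1⟩, rfl⟩
    have hed : e ≤ |dist p q - ρ'| := by
      by_contra hlt
      exact hball (mem_ball.2 (by rw [Real.dist_eq]; exact not_le.1 hlt)) hdD
    rcases le_abs'.1 hed with h1 | h1
    · left
      linarith
    · right
      linarith
  · right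
    linarith [min_le_right e (ρ + 1 - ρ')]

/-! ## The local pairing -/

/-- **Local pairing.** Let `X ⊆ ℝ³` be `δ_X`-separated, `y` a `δ`-separated finite configuration,
`p ∈ X`, and `ρ', g` a generic radius and gap at `p` (no point of `X` at distance in
`(ρ' − g, ρ' + g)` from `p`). Suppose `2ε < δ`, `2ε < δ_X`, `2ε < g`, that `y` and `X` are two-way
`ε`-matched on the ball `‖·‖ ≤ R` with `‖p‖ + ρ' + ε ≤ R`, and that particle `i` is within `ε` of `p`.
Then there is a map `m` sending every particle `a ≠ i` within `ρ'` of particle `i` to a point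
`m a ∈ X ∖ {p}` within `ρ'` of `p` and within `ε` of `y a`, injective on these particles, and hitting
every point of `X ∖ {p}` within `ρ'` of `p`. -/
theorem exists_local_pairing {X : Set (EuclideanSpace ℝ (Fin 3))} {δX : ℝ}
    (hXsep : ∀ a ∈ X, ∀ b ∈ X, a ≠ b → δX ≤ dist a b) {N : ℕ}
    (y : Fin N → EuclideanSpace ℝ (Fin 3)) {δ : ℝ} (hsep : ∀ a b, a ≠ b → δ ≤ dist (y a) (y b))
    {p : EuclideanSpace ℝ (Fin 3)} (hp : p ∈ X) {ρ' g ε R : ℝ}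
    (hkey : ∀ q ∈ X, dist p q ≤ ρ' - g ∨ ρ' + g ≤ dist p q)
    (hεδ : 2 * ε < δ) (hεX : 2 * ε < δX) (hεg : 2 * ε < g) (hR : ‖p‖ + ρ' + ε ≤ R)
    (hM1 : ∀ q ∈ X, ‖q‖ ≤ R → ∃ a, dist (y a) q ≤ ε)
    (hM2 : ∀ a, ‖y a‖ ≤ R → ∃ q ∈ X, dist (y a) q ≤ ε)
    {i : Fin N} (hi : dist (y i) p ≤ ε) :
    ∃ m : Fin N → EuclideanSpace ℝ (Fin 3),
      (∀ a ∈ (Finset.univ.erase i).filter (fun a => dist (y i) (y a) ≤ ρ'),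
          m a ∈ X ∧ m a ≠ p ∧ dist p (m a) ≤ ρ' ∧ dist (y a) (m a) ≤ ε) ∧
      Set.InjOn m ((Finset.univ.erase i).filter fun a => dist (y i) (y a) ≤ ρ') ∧
      ∀ q ∈ X, q ≠ p → dist p q ≤ ρ' →
        ∃ a ∈ (Finset.univ.erase i).filter (fun a => dist (y i) (y a) ≤ ρ'), m a = q := by
  classical
  have hε0 : 0 ≤ ε := dist_nonneg.trans hi
  -- two points of `X` (resp. two particles) within `ε` of one point coincide
  have huX : ∀ c q q' : EuclideanSpace ℝ (Fin 3), q ∈ X → q' ∈ X →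
      dist c q ≤ ε → dist c q' ≤ ε → q = q' := by
    intro c q q' hq hq' h1 h2
    by_contra hne
    have h3 := hXsep q hq q' hq' hne
    linarith [dist_triangle_left q q' c]
  have huY : ∀ (a b : Fin N) (c : EuclideanSpace ℝ (Fin 3)),
      dist (y a) c ≤ ε → dist (y b) c ≤ ε → a = b := by
    intro a b c h1 h2
    by_contra hne
    have h3 := hsep a b hne
    linarith [dist_triangle_right (y a) (y b) c]
  -- the matching map: the point of `X` within `ε` of the particle, if any
  set m : Fin N → EuclideanSpace ℝ (Fin 3) :=
    fun a => if h : ∃ q ∈ X, dist (y a) q ≤ ε then h.choose else p with hm_def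
  have hm : ∀ a, (∃ q ∈ X, dist (y a) q ≤ ε) → m a ∈ X ∧ dist (y a) (m a) ≤ ε := by
    intro a h
    simp only [hm_def, dif_pos h]
    exact h.choose_spec
  set I := (Finset.univ.erase i).filter fun a => dist (y i) (y a) ≤ ρ' with hI_def
  have hmemI : ∀ a, a ∈ I ↔ a ≠ i ∧ dist (y i) (y a) ≤ ρ' := fun a => by
    simp only [hI_def, Finset.mem_filter, Finset.mem_erase, Finset.mem_univ, and_true]
  -- every inner particle lies in the matched ball, hence is matched
  have hF1 : ∀ a ∈ I, m a ∈ X ∧ dist (y a) (m a) ≤ ε := by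
    intro a ha
    refine hm a (hM2 a ?_)
    have h1 := norm_le_norm_add_norm_sub' (y a) p
    rw [← dist_eq_norm] at h1
    linarith [dist_triangle (y a) (y i) p, dist_comm (y a) (y i), ((hmemI a).1 ha).2]
  refine ⟨m, fun a ha => ?_,
    fun a ha b hb hab => huY a b (m a) (hF1 a ha).2 (hab ▸ (hF1 b hb).2),
    fun q hq hqp hqρ => ?_⟩
  · obtain ⟨hai, hda⟩ := (hmemI a).1 ha
    obtain ⟨hmX, hmd⟩ := hF1 a ha
    have hδa : δ ≤ dist (y i) (y a) := hsep i a (Ne.symm hai)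
    have hne : m a ≠ p := by
      intro h
      rw [h] at hmd
      linarith [dist_triangle_right (y i) (y a) p]
    have hlt : dist p (m a) < ρ' + g := by
      linarith [dist_triangle4 p (y i) (y a) (m a), dist_comm p (y i)]
    refine ⟨hmX, hne, ?_, hmd⟩
    rcases hkey (m a) hmX with h | h
    · linarith
    · exact absurd hlt (not_lt.2 h)
  · have h1 := norm_le_norm_add_norm_sub' q p
    rw [← dist_eq_norm, dist_comm] at h1
    obtain ⟨a, ha⟩ := hM1 q hq (by linarith)
    have hδq : δX ≤ dist p q := hXsep p hp q hq (Ne.symm hqp)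
    have hai : a ≠ i := by
      intro h
      rw [h] at ha
      linarith [dist_triangle_left p q (y i)]
    have hqg : dist p q ≤ ρ' - g := by
      rcases hkey q hq with h | h
      · exact h
      · linarith
    have haI : a ∈ I :=
      (hmemI a).2 ⟨hai, by linarith [dist_triangle4 (y i) p q (y a), dist_comm (y a) q]⟩
    exact ⟨a, haI, huX (y a) _ _ (hF1 a haI).1 hq (hF1 a haI).2 ha⟩

/-! ## The registered stub -/

/-- **STUB 4 of `Cruxes/TransitiveLocalLimit/Lines/birth.lean` — CONTINUITY OF SITE ENERGIES UNDER
SEPARATED LOCAL CONVERGENCE** (the registered signature, verbatim): if uniformly `δ`-separated finite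
configurations `z j` of `ℝ³` converge locally (two-way matching on every ball about `0`, eventually in
`j`) to a uniformly discrete `X`, then for every `p ∈ X` and `γ > 0` there is `ε > 0` such that,
eventually in `j`, every particle within `ε` of `p` has Lennard-Jones site energy within `γ` of
`Σ'_{q ∈ X, q ≠ p} V_LJ(|p − q|)`. Proof in the module docstring: tails beyond a generic radius `ρ'`
are `≤ γ/4` on both sides, and the inner sums are compared termwise along the local pairing, using a
modulus of continuity of `V_LJ` on `[min δ δ_X, ρ + 2]`. -/
theorem stub_siteEnergyContinuity : ∀ (n : ℕ → ℕ) (z : (j : ℕ) → (Fin (n j) → EuclideanSpace ℝ (Fin 3))) (X : Set (EuclideanSpace ℝ (Fin 3))) (δ : ℝ), 0 < δ → (∀ (j : ℕ) (i i' : Fin (n j)), i ≠ i' → δ ≤ dist (z j i) (z j i')) → (∃ δ : ℝ, 0 < δ ∧ ∀ p ∈ X, ∀ q ∈ X, p ≠ q → δ ≤ dist p q) → (∀ R ε : ℝ, 0 < ε → ∀ᶠ j : ℕ in Filter.atTop, (∀ p ∈ X, ‖p‖ ≤ R → ∃ i : Fin (n j), dist (z j i) p ≤ ε) ∧ (∀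 i : Fin (n j), ‖z j i‖ ≤ R → ∃ p ∈ X, dist (z j i) p ≤ ε)) → ∀ p ∈ X, ∀ γ : ℝ, 0 < γ → ∃ ε : ℝ, 0 < ε ∧ ∀ᶠ j : ℕ in Filter.atTop, ∀ i : Fin (n j), dist (z j i) p ≤ ε → |Literature.MathematicalPhysics.StatisticalMechanics.siteEnergy Literature.MathematicalPhysics.StatisticalMechanics.lennardJones (z j) i - ∑' q : {q : EuclideanSpace ℝ (Fin 3) // q ∈ X ∧ q ≠ p}, Literature.MathematicalPhysics.StatisticalMechanics.lennardJones (dist p q.1)| ≤ γ := by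
  intro n z X δ hδ hsep hX hmatch p hp γ hγ
  obtain ⟨δX, hδX, hXsep⟩ := hX
  -- one separation constant for both systems, and the tail constant
  set η : ℝ := min δ δX with hη_def
  have hη : 0 < η := lt_min hδ hδX
  have hηδ : η ≤ δ := min_le_left _ _
  have hηX : η ≤ δX := min_le_right _ _
  set C : ℝ := (η⁻¹ ^ 6 / 12 + 1 / 6) * (250 * η⁻¹ ^ 3) with hC_def
  have hC : 0 ≤ C := by positivity
  -- (1) the tail radius
  obtain ⟨ρ, hηρ, hCρ⟩ : ∃ ρ : ℝ, η ≤ ρ ∧ C * ρ⁻¹ ^ 3 ≤ γ / 4 := by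
    refine ⟨max (max η 1) (4 * C / γ), (le_max_left _ _).trans (le_max_left _ _), ?_⟩
    set ρ := max (max η 1) (4 * C / γ) with hρ_def
    have hρ1 : 1 ≤ ρ := (le_max_right _ _).trans (le_max_left _ _)
    have hρ0 : 0 < ρ := one_pos.trans_le hρ1
    have h1 : ρ⁻¹ ^ 3 ≤ ρ⁻¹ :=
      pow_le_of_le_one (inv_nonneg.2 hρ0.le) (inv_le_one_of_one_le₀ hρ1) three_ne_zero
    have h2 : C * ρ⁻¹ ≤ γ / 4 := by
      have h3 : 4 * C / γ ≤ ρ := le_max_right _ _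
      rw [div_le_iff₀ hγ] at h3
      rw [← div_eq_mul_inv, div_le_iff₀ hρ0]
      linarith
    exact (mul_le_mul_of_nonneg_left h1 hC).trans h2
  -- (2) the generic radius
  obtain ⟨ρ', g, hg, hρρ', hρ'g, hkey⟩ := exists_generic_shell_radius hδX hXsep p ρ
  -- the limit field at `p`: summable, with finitely many inner points
  have hf : Summable fun q : {q : EuclideanSpace ℝ (Fin 3) // q ∈ X ∧ q ≠ p} =>
      lennardJones (dist p q.1) :=
    (UniformlyDiscrete.summable_lennardJones_dist ⟨δX, hδX, hXsep⟩ p).comp_injective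
      (i := fun q : {q : EuclideanSpace ℝ (Fin 3) // q ∈ X ∧ q ≠ p} => (⟨q.1, q.2.1⟩ : X))
      fun a b hab => Subtype.ext (congrArg Subtype.val hab :)
  have hTfin : {q : {q : EuclideanSpace ℝ (Fin 3) // q ∈ X ∧ q ≠ p} | dist p q.1 ≤ ρ'}.Finite := by
    have hfinE : (X ∩ closedBall p ρ').Finite :=
      finite_of_forall_le_dist_of_subset_closedBall hδX
        (fun a ha b hb hab => hXsep a ha.1 b hb.1 hab) Set.inter_subset_right
    exact (hfinE.preimage Subtype.val_injective.injOn).subset fun q hq =>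
      ⟨q.2.1, mem_closedBall'.2 hq⟩
  set T := hTfin.toFinset with hT_def
  have hT : ∀ q, q ∈ T ↔ dist p q.1 ≤ ρ' := fun q => by
    rw [hT_def, Set.Finite.mem_toFinset, Set.mem_setOf_eq]
  -- (3) a modulus of continuity of `V_LJ` on `[η, ρ + 2]`, for the oscillation `γ / (4 (#T + 1))`
  set e : ℝ := γ / (4 * (T.card + 1)) with he_def
  have he : 0 < e := by positivity
  obtain ⟨ω, hω, hωV⟩ : ∃ ω > 0, ∀ a ∈ Set.Icc η (ρ + 2), ∀ b ∈ Set.Icc η (ρ + 2),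
      dist a b < ω → dist (lennardJones a) (lennardJones b) < e := by
    have hc : ContinuousOn lennardJones (Set.Icc η (ρ + 2)) :=
      continuousOn_lennardJones.mono fun a ha =>
        Set.mem_compl_singleton_iff.2 (hη.trans_le ha.1).ne'
    exact Metric.uniformContinuousOn_iff.1
      (isCompact_Icc.uniformContinuousOn_of_continuous hc) e he
  -- (4) the tolerance
  set ε : ℝ := min (g / 4) (min (η / 4) (ω / 3)) with hε_def
  have hε : 0 < ε := lt_min (by linarith) (lt_min (by linarith) (by linarith))
  have hεg : ε ≤ g / 4 := min_le_left _ _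
  have hεη : ε ≤ η / 4 := (min_le_right _ _).trans (min_le_left _ _)
  have hεω : ε ≤ ω / 3 := (min_le_right _ _).trans (min_le_right _ _)
  refine ⟨ε, hε, ?_⟩
  filter_upwards [hmatch (‖p‖ + ρ + 2) ε hε] with j hj i hi
  obtain ⟨hM1, hM2⟩ := hj
  -- (5) the pairing of the inner particles with the inner points
  obtain ⟨m, hm, hminj, hmsurj⟩ := exists_local_pairing hXsep (z j) (hsep j) hp hkey
    (by linarith) (by linarith) (by linarith) (by linarith) hM1 hM2 hi
  set I := (Finset.univ.erase i).filter fun a => dist (z j i) (z j a) ≤ ρ' with hI_def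
  set F := (Finset.univ.erase i).filter fun a => ¬dist (z j i) (z j a) ≤ ρ' with hF_def
  have hA : siteEnergy lennardJones (z j) i =
      ∑ a ∈ I, lennardJones (dist (z j i) (z j a)) +
        ∑ a ∈ F, lennardJones (dist (z j i) (z j a)) := by
    rw [hI_def, hF_def, Finset.sum_filter_add_sum_filter_not]
    rfl
  -- transport of sums over the inner points of `X` to the inner particles
  have hbij : ∀ φ : EuclideanSpace ℝ (Fin 3) → ℝ, ∑ q ∈ T, φ q.1 = ∑ a ∈ I, φ (m a) := by
    intro φ
    symm
    refine Finset.sum_bij (fun a ha => ⟨m a, (hm a ha).1, (hm a ha).2.1⟩)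
      (fun a ha => (hT _).2 (hm a ha).2.2.1)
      (fun a ha b hb hab => hminj ha hb (congrArg Subtype.val hab :)) (fun q hq => ?_)
      fun a _ => rfl
    obtain ⟨a, ha, hq'⟩ := hmsurj q.1 q.2.1 q.2.2 ((hT q).1 hq)
    exact ⟨a, ha, Subtype.ext hq'⟩
  have hcard : ((T.card : ℕ) : ℝ) = I.card := by simpa using hbij fun _ => 1
  -- the three error terms
  have herr : |∑ a ∈ I, lennardJones (dist (z j i) (z j a)) -
      ∑ a ∈ I, lennardJones (dist p (m a))| ≤ γ / 4 := by
    rw [← Finset.sum_sub_distrib]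
    refine (Finset.abs_sum_le_sum_abs _ _).trans ?_
    have hterm : ∀ a ∈ I,
        |lennardJones (dist (z j i) (z j a)) - lennardJones (dist p (m a))| ≤ e := by
      intro a ha
      obtain ⟨hmX, hmp, hmρ, hmd⟩ := hm a ha
      have ha' := Finset.mem_filter.1 ha
      have hai : a ≠ i := Finset.ne_of_mem_erase ha'.1
      have h1 : dist (z j i) (z j a) ∈ Set.Icc η (ρ + 2) :=
        ⟨hηδ.trans (hsep j i a hai.symm), by linarith [ha'.2]⟩
      have h2 : dist p (m a) ∈ Set.Icc η (ρ + 2) :=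
        ⟨hηX.trans (hXsep p hp (m a) hmX hmp.symm), by linarith⟩
      have h3 : dist (dist (z j i) (z j a)) (dist p (m a)) < ω :=
        (dist_dist_dist_le _ _ _ _).trans_lt (by linarith)
      have h4 := hωV _ h1 _ h2 h3
      rw [Real.dist_eq] at h4
      exact h4.le
    refine (Finset.sum_le_sum hterm).trans ?_
    rw [Finset.sum_const, nsmul_eq_mul, ← hcard]
    have h5 : ((T.card : ℝ) + 1) * e = γ / 4 := by
      rw [he_def]
      field_simp
    linarith [he.le]
  have hfarY : |∑ a ∈ F, lennardJones (dist (z j i) (z j a))| ≤ γ / 4 := by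
    refine (Finset.abs_sum_le_sum_abs _ _).trans ?_
    refine (sum_abs_lennardJones_le_of_le_dist F (z j) (z j i) hη hηρ
      (fun a _ b _ hab => hηδ.trans (hsep j a b hab)) fun a ha => ?_).trans hCρ
    have h1 := (Finset.mem_filter.1 ha).2
    linarith [not_le.1 h1]
  refine abs_sub_tsum_le_of_forall_finset hf T fun T' hTT' => ?_
  have hfarX : |∑ q ∈ T' \ T, lennardJones (dist p q.1)| ≤ γ / 4 := by
    refine (Finset.abs_sum_le_sum_abs _ _).trans ?_
    refine (sum_abs_lennardJones_le_of_le_dist (T' \ T)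
      (fun q : {q : EuclideanSpace ℝ (Fin 3) // q ∈ X ∧ q ≠ p} => q.1) p hη hηρ
      (fun a _ b _ hab => hηX.trans (hXsep _ a.2.1 _ b.2.1 fun h => hab (Subtype.ext h)))
      fun q hq => ?_).trans hCρ
    have h1 : ¬dist p q.1 ≤ ρ' := fun h => (Finset.mem_sdiff.1 hq).2 ((hT q).2 h)
    linarith [not_le.1 h1]
  -- assembly
  have hsum : ∑ q ∈ T', lennardJones (dist p q.1) =
      ∑ a ∈ I, lennardJones (dist p (m a)) + ∑ q ∈ T' \ T, lennardJones (dist p q.1) := by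
    rw [← Finset.sum_sdiff hTT', add_comm, hbij fun x => lennardJones (dist p x)]
  rw [hA, hsum]
  obtain ⟨h1a, h1b⟩ := abs_le.1 herr
  obtain ⟨h2a, h2b⟩ := abs_le.1 hfarY
  obtain ⟨h3a, h3b⟩ := abs_le.1 hfarX
  exact abs_le.2 ⟨by linarith, by linarith⟩

end Summit.AtomisticToContinuum.Crystallization.Theorems.TransitiveLocalLimitBirth

end
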